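import Mathlib
import Literature.Analysis.OperatorTheory.Enflo2023.Basic
import Literature.Analysis.OperatorTheory.Enflo2023.Vy
import Literature.Analysis.OperatorTheory.Enflo2023.Type2LargeL
import Literature.Analysis.OperatorTheory.Enflo2023.Type2Sensitivity
import Literature.Analysis.OperatorTheory.Enflo2023.Type2PrintedHarmless
import Literature.Analysis.InnerProduct.WeakSubsequence
import HarnessLib

/-!
# Enflo (2023), the type-2 branch END TO END in the printed reading — claimed result under adjudication

P. Enflo, *On the invariant subspace problem in Hilbert spaces*, arXiv:2305.15442 (v2), p.7 (types 1/2, the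
normalised `y_n` with `⟨y_n, u₀⟩ ≥ 1/100`) and pp.20–22 ((20), (21), the threshold `L₀`, (47)).

Nothing here asserts the manuscript's theorem.  This module closes the bookkeeping gap recorded by the referee
(HANDOFF gen-15/16, optional item (b)): `Type2PrintedHarmless.printed_eq47_of_data` obtains the PRINTED (all-`n`)
form of (47) under the p.7 per-index constraint `‖y + s_n‖ = 1`, `Re⟨u₀, y + s_n⟩ ≥ 1/100`, but
`Type2LargeL.eq20_of_type2` did not EXPORT that constraint (it exports only the weak limit `y` and `‖s_n‖ ≤ 2`).
Here:

* `eq20_of_type2_perIndex` — the construction of `eq20_of_type2` (normalise the type-2 vectors, pass to a weakly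
  convergent subsequence `z_{φ(n)} ⇀ y`, put `s_n := z_{φ(n)} − y`) with the two extra conjuncts
  `‖y + s_n‖ = 1` and `Re⟨u₀, y + s_n⟩ ≥ 1/100` exported (they hold because `y + s_n = z_{φ(n)}` IS the normalised
  type-2 vector);
* `printed_eq47_of_type2` — from the DEFINITION of type 2 (`Referee.Type2`), `‖T‖ < 1`, `T†` injective and unit
  vectors `u₀, x₀`: either a non-trivial closed invariant subspace, or data `(m, y, s_n, L₀)` with (20), the PRINTED
  thresholds (`MovesBounded`, all `n`) and the PRINTED conclusion of (47) (moves of `y + L₀ s_n` into the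
  `r`-ball, `r ∈ [3/10, 3/10 + δ]`, with `0 ≤ (εθ) < c`, for `n ≥ N` arbitrarily late) — i.e. STEPS row B30 holds in
  Lean end to end from the definition of type 2, in the printed reading, because the per-index constraint excludes
  the rogue-index mechanism of `printed_eq47_fails` (`Type2PrintedHarmless.data_ne_zero`).

The manuscript then restarts the MC iteration from these `y'_n` (p.22), where it meets the unrepaired Part A input
(27)/(33) and the first-order step analysis (34)–(45) exactly as in the type-1 branch (tree modules `PivotRoom`,
`Eq40`, `Eq45`).
-/

noncomputable section

open scoped InnerProductSpace
open Filter Topology RCLike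

namespace Literature.Analysis.OperatorTheory.Enflo2023

namespace Type2

variable {H : Type*} [NormedAddCommGroup H] [InnerProductSpace ℂ H]

/-- (20) from the definition of type 2, WITH the p.7 per-index constraint exported: the normalised type-2 vectors
`z_{φ(n)} = y + s_n` are unit vectors with `Re⟨u₀, z_{φ(n)}⟩ ≥ 1/100`. [cite: Enflo2023, v2 p.7 and p.20 (20)] -/
theorem eq20_of_type2_perIndex [CompleteSpace H] (T : H →L[ℂ] H) (hT2 : Referee.Type2 T) (u₀ : H)
    (hu₀ : ‖u₀‖ = 1) :
    ∃ (m : ℕ) (y : H) (s : ℕ → H), 1 ≤ m ∧ ‖y‖ ≤ 1 ∧ (1 / 100 : ℝ) ≤ re ⟪u₀, y⟫_ℂ ∧ y ≠ 0 ∧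
      (∀ n, ‖s n‖ ≤ 2) ∧ (∀ v : H, Tendsto (fun n => ⟪v, s n⟫_ℂ) atTop (𝓝 0)) ∧
      (∀ j, m ≤ j → Tendsto (fun n => ⟪y, (T ^ j) y⟫_ℂ + ⟪s n, (T ^ j) (s n)⟫_ℂ) atTop (𝓝 0)) ∧
      (∀ n, ‖y + s n‖ = 1) ∧ (∀ n, (1 / 100 : ℝ) ≤ re ⟪u₀, y + s n⟫_ℂ) := by
  obtain ⟨m, hm, hδ⟩ := hT2 u₀ hu₀
  have hch : ∀ n : ℕ, ∃ y : H, Referee.AngleCond u₀ y ∧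
      ∀ j : ℕ, m ≤ j → ‖⟪(⇑T)^[j] y, y⟫_ℂ‖ ≤ (1 / ((n : ℝ) + 1)) * ‖y‖ ^ 2 :=
    fun n => hδ _ (by positivity)
  choose yseq hyseq using hch
  have hy0 : ∀ n, yseq n ≠ 0 := fun n => (hyseq n).1.1
  have hypos : ∀ n, 0 < ‖yseq n‖ := fun n => norm_pos_iff.2 (hy0 n)
  set z : ℕ → H := fun n => ((‖yseq n‖⁻¹ : ℝ) : ℂ) • yseq n with hz_def
  have hz_norm : ∀ n, ‖z n‖ = 1 := fun n => by
    rw [hz_def]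
    simp only
    rw [norm_smul, Complex.norm_real, Real.norm_of_nonneg (inv_nonneg.2 (norm_nonneg _)),
      inv_mul_cancel₀ (hypos n).ne']
  have hz_re : ∀ n, (1 / 100 : ℝ) ≤ re ⟪u₀, z n⟫_ℂ := fun n => by
    have h := (hyseq n).1.2
    rw [hz_def]
    simp only
    rw [inner_smul_right, re_ofReal_mul']
    have : (1 / 100 : ℝ) = ‖yseq n‖⁻¹ * ((1 / 100 : ℝ) * ‖yseq n‖) := by
      rw [mul_left_comm, inv_mul_cancel₀ (hypos n).ne', mul_one]
    rw [this]
    have h' : (1 / 100 : ℝ) * ‖yseq n‖ ≤ re ⟪u₀, yseq n⟫_ℂ := by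
      rw [RCLike.re_to_complex]; exact h
    exact mul_le_mul_of_nonneg_left h' (inv_nonneg.2 (norm_nonneg _))
  have hz_t2 : ∀ n j, m ≤ j → ‖⟪z n, (T ^ j) (z n)⟫_ℂ‖ ≤ 1 / ((n : ℝ) + 1) := fun n j hj => by
    have h := (hyseq n).2 j hj
    rw [← ContinuousLinearMap.coe_pow'] at h
    rw [hz_def]
    simp only
    rw [map_smul, inner_smul_left, inner_smul_right, Complex.conj_ofReal, ← mul_assoc, norm_mul, norm_mul,
      Complex.norm_real, Real.norm_of_nonneg (inv_nonneg.2 (norm_nonneg _)), norm_inner_symm]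
    have hn2 : ‖yseq n‖⁻¹ * ‖yseq n‖⁻¹ * (1 / ((n : ℝ) + 1) * ‖yseq n‖ ^ 2) = 1 / ((n : ℝ) + 1) :=
      calc ‖yseq n‖⁻¹ * ‖yseq n‖⁻¹ * (1 / ((n : ℝ) + 1) * ‖yseq n‖ ^ 2)
          = 1 / ((n : ℝ) + 1) * (‖yseq n‖⁻¹ * ‖yseq n‖) ^ 2 := by ring
        _ = 1 / ((n : ℝ) + 1) := by rw [inv_mul_cancel₀ (hypos n).ne', one_pow, mul_one]
    calc ‖yseq n‖⁻¹ * ‖yseq n‖⁻¹ * ‖⟪(T ^ j) (yseq n), yseq n⟫_ℂ‖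
        ≤ ‖yseq n‖⁻¹ * ‖yseq n‖⁻¹ * (1 / ((n : ℝ) + 1) * ‖yseq n‖ ^ 2) := by
          exact mul_le_mul_of_nonneg_left h (by positivity)
      _ = 1 / ((n : ℝ) + 1) := hn2
  obtain ⟨φ, w, hφ, hw, hweak⟩ :=
    Literature.Analysis.InnerProduct.exists_strictMono_tendsto_inner_of_norm_le (𝕜 := ℂ) (v := z) (M := 1)
      (fun n => (hz_norm n).le)
  have hw_re : (1 / 100 : ℝ) ≤ re ⟪u₀, w⟫_ℂ :=
    ge_of_tendsto' ((continuous_re.tendsto _).comp (hweak u₀)) fun n => hz_re (φ n)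
  have hw0 : w ≠ 0 := by
    intro h0
    rw [h0, inner_zero_right, map_zero] at hw_re
    linarith
  have hδ0 : Tendsto (fun n => 1 / ((φ n : ℝ) + 1)) atTop (𝓝 0) := by
    have h1 : Tendsto (fun n : ℕ => 1 / ((n : ℝ) + 1)) atTop (𝓝 0) := tendsto_one_div_add_atTop_nhds_zero_nat
    exact h1.comp hφ.tendsto_atTop
  have hsum : ∀ n, w + (z (φ n) - w) = z (φ n) := fun n => add_sub_cancel w (z (φ n))
  refine ⟨m, w, fun n => z (φ n) - w, hm, hw, hw_re, hw0, fun n => ?_, fun v => ?_, fun j hj => ?_,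
    fun n => ?_, fun n => ?_⟩
  · calc ‖z (φ n) - w‖ ≤ ‖z (φ n)‖ + ‖w‖ := norm_sub_le _ _
      _ ≤ 1 + 1 := add_le_add (hz_norm _).le hw
      _ = 2 := by norm_num
  · have h1 : Tendsto (fun n => ⟪v, z (φ n)⟫_ℂ - ⟪v, w⟫_ℂ) atTop (𝓝 (⟪v, w⟫_ℂ - ⟪v, w⟫_ℂ)) :=
      (hweak v).sub_const _
    rw [sub_self] at h1
    refine h1.congr fun n => ?_
    rw [inner_sub_right]
  · exact eq20_of_weakLimit T m (z ∘ φ) w hweak (fun n => 1 / ((φ n : ℝ) + 1)) hδ0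
      (fun n j hj => hz_t2 (φ n) j hj) j hj
  · rw [hsum]; exact hz_norm _
  · rw [hsum]; exact hz_re _

/-- **The type-2 branch end to end, printed reading** (v2 p.7 + pp.20–22): from the definition of type 2 with unit
vector `u₀`, `‖T‖ < 1`, `T†` injective and any unit vector `x₀`: either `T` has a non-trivial closed invariant
subspace, or there are `m ≥ 1`, `y ≠ 0` (`‖y‖ ≤ 1`, `Re⟨u₀, y⟩ ≥ 1/100`), `s_n` (`‖s_n‖ ≤ 2`, weakly null, with
the per-index constraint `‖y + s_n‖ = 1`, `Re⟨u₀, y + s_n⟩ ≥ 1/100`) satisfying (20), a threshold `L₀ > 0` for the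
PRINTED all-`n` boundedness of the minimal moves, and the printed conclusion of (47).
[cite: Enflo2023, v2 pp.7, 20–22, (20), (47)] -/
theorem printed_eq47_of_type2 [CompleteSpace H] (T : H →L[ℂ] H) (hT : ‖T‖ < 1)
    (hTinj : Function.Injective (ContinuousLinearMap.adjoint T)) (hT2 : Referee.Type2 T)
    (u₀ : H) (hu₀ : ‖u₀‖ = 1) (x₀ : H) (hx₀ : ‖x₀‖ = 1) :
    HasNontrivialClosedInvariantSubspace T ∨
      ∃ (m : ℕ) (y : H) (s : ℕ → H), 1 ≤ m ∧ y ≠ 0 ∧ ‖y‖ ≤ 1 ∧ (1 / 100 : ℝ) ≤ re ⟪u₀, y⟫_ℂ ∧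
        (∀ n, ‖s n‖ ≤ 2) ∧ (∀ v : H, Tendsto (fun n => ⟪v, s n⟫_ℂ) atTop (𝓝 0)) ∧
        (∀ j, m ≤ j → Tendsto (fun n => ⟪y, (T ^ j) y⟫_ℂ + ⟪s n, (T ^ j) (s n)⟫_ℂ) atTop (𝓝 0)) ∧
        (∀ n, ‖y + s n‖ = 1) ∧ (∀ n, (1 / 100 : ℝ) ≤ re ⟪u₀, y + s n⟫_ℂ) ∧
        ∃ L₀ : ℝ, 0 < L₀ ∧ (∀ L, 0 < L → L < L₀ → MovesBounded T hT x₀ y s L) ∧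
          (∀ δ > 0, ∃ L, L₀ ≤ L ∧ L < L₀ + δ ∧ 0 < L ∧ ¬ MovesBounded T hT x₀ y s L) ∧
          ∀ c > 0, ∀ δ > 0, ∀ N : ℕ, ∃ n, N ≤ n ∧ ∃ r : ℝ, 3 / 10 ≤ r ∧ r ≤ 3 / 10 + δ ∧ ∃ a : Vy.ℓ2,
            IsMinimal (Vy.V T hT (y + (L₀ : ℂ) • s n)) x₀ r a ∧
            0 ≤ re ⟪x₀ - Vy.V T hT (y + (L₀ : ℂ) • s n) a, Vy.V T hT (y + (L₀ : ℂ) • s n) a⟫_ℂ ∧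
            re ⟪x₀ - Vy.V T hT (y + (L₀ : ℂ) • s n) a, Vy.V T hT (y + (L₀ : ℂ) • s n) a⟫_ℂ < c := by
  obtain ⟨m, y, s, hm, hy1, hre, hy0, hs2, hs, h20, hunit, hang⟩ := eq20_of_type2_perIndex T hT2 u₀ hu₀
  rcases type2_threshold_or_NIS T hT hTinj m hx₀ hy0 hs2 hs h20 with h | ⟨L₀, hL₀, hbelow, habove⟩
  · exact Or.inl h
  · rcases printed_eq47_of_data T hT hx₀ hy1 hre hunit hang hs2 hs hL₀ hbelow habove with h | h47
    · exact Or.inl h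
    · exact Or.inr ⟨m, y, s, hm, hy0, hy1, hre, hs2, hs, h20, hunit, hang, L₀, hL₀, hbelow, habove, h47⟩

end Type2

end Literature.Analysis.OperatorTheory.Enflo2023
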